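import Summits.QuantumAdvantage.AdviceFreeQNC0.AffBells30Cert

/-!
# Joint-phase certificate — part 2/3: §C.4 the drop-set form, §C.5 `HDrop → HAbs → (NP₁)`, §C.6 the threshold records `HWideE`/`HCert`

VERBATIM split (400-line rule) of planner qa-qnc0-p1 g30's `HOME/qa-qnc0-p1/exp30/Cert30.lean` (sha16 `d540ad8703b716ed`, 715 lines = the referee's
pin `Cert30.pre3final.lean`; farm rc 0 / 0 sorry / 0 warnings; authored AND proved by the planner seat; landed by qn-prover-3 g15, ask P-30c) into
`AffBells30Cert.lean` (§C.1–§C.3), `AffBells30Drop.lean` (§C.4–§C.6), `AffBells30Block.lean` (§C.7–§C.8); only file boundaries, per-file preambles,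
these header lines and one-line docstrings on undocumented auxiliaries are new.  NOTE: `HWideE`/`HCert` (§C.6) are labelled REFUTED-AS-TYPED records
by the planner; the live conjectures are `HDrop` (§C.5) ⇐ `HBlock` (§C.7) ⇐ `HPart` (§C.8).  The planner's module docstring follows.

# Cert30 (planner qn-p1 g30, ROUND-29): the JOINT-PHASE CERTIFICATE engine (PROVED), the DROP-SET form `HDrop` of the wide-parity
conjecture (`HDrop → HAbs → (NP₁)` PROVED), and the BLOCK-BALANCE form `HBlock` (`HBlock → HDrop` PROVED)

Context.  The frame-shadow / transfer reduction (`AffBells29Shadow`, `AffBells29Transfer`, tree) leaves ONE conjecture feeding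
`HAbs`: far affine strategies with few coin-pair cut points admit a low-degree competitor for the firing PARITY.  ROUND-29 (this
round) REFUTES every THRESHOLD-defined form of that conjecture (tree `AffBells29.HWide` with the fixed width `C·log₂N`; the
width-existential `HWideE` and the threshold certificate `HCert` of §C.6; `AffBells29.HShape`): sparse-core pure run tilings (lit L-36
own-position designs on random sparse ±1 cores of ANY width `s`, graded over `s ∈ [0, C log N]`) are far, have NO cut points, and violate
`WideParityAt w` at ≈ 50 % of the odd class for every `w` they straddle (R3; numerics K-44p / `grt_check*.py`).  What survives is the
tree's `HAbs` (competitor `z'` FREE): for those tilings `z'` = «drop whole runs» works.  Hence the live forms below let the PLANNER choose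
the set `D` of dropped rows per `(N, β, c)` (whole twin blocks, never a width threshold); the only constraint is that the KEPT rows are
polylog-narrow (so that `readsOnly_shadow`/`bitFn_drop_lowDeg` give the low-degree competitor).

* §C.1–C.3 THE ENGINE (c enters only through `x ∉ cutPoints β c`; radius ONE).  Data at an odd point `x`: a partition `s` of the
  active rows each part inside or disjoint from the designated set `W`, coin pairs `P`, a shift table `δ` with every pair shifting every
  row of a part uniformly (`UniformShift`), and the CERTIFICATE parities (`CertShapeW W β x`: the number of pairs shifting part `k` by `+1`,
  resp. by `−1`, is odd iff `k ⊆ W`).  **`desigParity_of_cert` (PROVED):** `x ∉ cutPoints β c ∧ CertShapeW W β x ⇒ DesigParityAt W β c x`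
  (the rows of `W` fire with parity `≡ |W ∩ act x|`).  Linear-algebra reading: purity at `x` ⟺ the imbalance vector `(A,B)(x)` lies in
  the nullspace of the pair/class incidence matrix `E(x)` over `𝔽₂`; the certificate ⟺ `(𝟙_W,𝟙_W) ∈ rowspace E(x)`.  Census K-44p
  (j317453, 16 families, N ≤ 192, 300 points/cell): the certificate holds at 1.00 of CLEAN points (no class mixing designated and kept
  rows, no coin-poor designated row) in every family from N = 72 on, frames included; it fails exactly at mixed classes and coin-poor rows.
* §C.4–C.5 THE DROP-SET FORM.  `dropRow/dropOff/dropAct/DropParityAt`; `dropParity_of_cert`; **`HDrop`** := far ∧ few cut points ⇒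
  `∃ D` (kept rows of width `≤ (log₂N)^C`) with `DropParityAt D` at all but `ε·2^{N−1}` odd points; **`hAbs_of_hDrop`, `polyLoss_of_hDrop`
  (PROVED)**.  RISK R4 (NESTED-RUN CHAINS, numerics `r4_check.py`): pure runs on nested cores `v₁ ⊂ v₂ ⊂ …` are far and cut-free, `HDrop`
  holds with `D` = the runs above any core-width threshold, but the boundary runs MERGE into one coin class at ≈ 2/3 of the points, where
  no pointwise certificate exists (cert 0.38 vs DropParity 1.00 at N = 96): the certificate is a LEMMA for generic points, not the theorem.
* §C.7 THE BLOCK-BALANCE FORM (the statement the proof architecture of ROUND-29 §6 actually targets).  `BlockBalancedAt L D β c x`: the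
  designated active rows split into parts, each COHERENT (sign-twins on the coins outside a set of ≤ L positions — a common phase) and
  SIGNED-PHASE-BALANCED (its three phase counts have equal parity); **`blockBalanced_dropParity` (PROVED)**; **`HBlock`** := far ∧ few cut
  points ⇒ `∃ D`, block balance a.e.; **`hDrop_of_hBlock`, `polyLoss_of_hBlock` (PROVED)**.  Per-CLASS balance is FALSE for pure non-twin
  designs (lit `nbr2s6`, `s7a`: 0/40, 2/40 points) while whole RUNS are balanced parts — hence parts are coherent blocks, not classes.
* §C.8 THE PART-PARITY FORM `HPart` (the weakest typed target): coherent parts each firing with parity `≡` its size; **`partParity_dropParity`,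
  `blockBalanced_partParity`, `partParity_of_cert` (= the engine, part by part), `hDrop_of_hPart`, `hPart_of_hBlock`, `polyLoss_of_hPart` (PROVED)** — so
  `HBlock → HPart → HDrop → HAbs → (NP₁)`, and a prover may target whichever of the three is most convenient.
* §C.6 RECORD ONLY: `HWideE`, `HCert` (REFUTED AS TYPED, R3) with their true implications, kept so the refutation has a typed referent.

WHAT THIS IS NOT: no claim about the crux `RingDenseResidualLt3`; `HDrop`/`HBlock` are conjectures (typed, unproved); nothing here
touches the route file; separation NOT moved.
-/

noncomputable section

open Classical

namespace Summit.QuantumAdvantage.AdviceFreeQNC0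

namespace AffBells30

open Finset Literature.Computability.QuantumComplexity Literature.Computability.QuantumComplexity.RingHLF
open Literature.Computability.MetaComplexity Literature.Computability.MetaComplexity.Smolensky
open AffBells23 AffBells26 Fib19 AffBells27 AffBells28 AffBells29

variable {N : ℕ}


/-! ### §C.4 The DROP-SET form (the live one): a planner-chosen set `D` of rows is dropped to constants

RISK R3 (ROUND-29 §2, numerically confirmed, `exp30/grt_check2.py`): every THRESHOLD-defined wide set (`wideAct w`) is refuted by the
SPARSE-CORE run-twin tilings — runs of six with a common sparse core `v_R` and own tweaks `t = (0,1,1,1,1,0)`: cut-free for EVERY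
core (the K-40 purity of own-position designs is core-independent), members of widths `s` and `s+1`, and at the straddled threshold
`w = s` the wide members `{1,2,3,4}` alone are NOT parity-pure (40/165 window×phase configurations; wide parity fails at ≈ half the
odd class).  The competitor must instead drop WHOLE runs: the dropped set is chosen per strategy, closed under twin blocks, never by
width.  Hence the drop-set form below: `D` arbitrary with a polylog-NARROW complement; dropped rows become the always-firing zero row. -/

/-- Dropped rows become the zero row … -/
def dropRow (D : Finset (Fin N)) (β : Fin N → Fin N → ZMod 3) : Fin N → Fin N → ZMod 3 :=
  fun b i => if b ∈ D then 0 else β b i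

/-- … with offset `0` (so they ALWAYS fire); kept rows are unchanged. -/
def dropOff (D : Finset (Fin N)) (c : Fin N → ZMod 3) : Fin N → ZMod 3 :=
  fun b => if b ∈ D then 0 else c b

/-- The dropped ACTIVE rows at `x`. -/
def dropAct (D : Finset (Fin N)) (x : Fin N → Bool) : Finset (Fin N) := (act x).filter fun g => g ∈ D

/-- **DROP PARITY at `x`**: the dropped active rows fire with parity `≡` their number. -/
def DropParityAt (D : Finset (Fin N)) (β : Fin N → Fin N → ZMod 3) (c : Fin N → ZMod 3) (x : Fin N → Bool) : Prop :=
  DesigParityAt (dropAct D x) β c x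

/-- Auxiliary `form_drop_in` of the joint-phase certificate engine (planner qa-qnc0-p1 g30, `Cert30.lean`, verbatim). -/
theorem form_drop_in (D : Finset (Fin N)) (β : Fin N → Fin N → ZMod 3) (x : Fin N → Bool) {b : Fin N} (hb : b ∈ D) :
    form (dropRow D β) x b = 0 := by
  unfold form dropRow
  simp [hb]

/-- Auxiliary `form_drop_out` of the joint-phase certificate engine (planner qa-qnc0-p1 g30, `Cert30.lean`, verbatim). -/
theorem form_drop_out (D : Finset (Fin N)) (β : Fin N → Fin N → ZMod 3) (x : Fin N → Bool) {b : Fin N} (hb : b ∉ D) :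
    form (dropRow D β) x b = form β x b := by
  unfold form dropRow
  simp [hb]

/-- Auxiliary `fires_drop_in` of the joint-phase certificate engine (planner qa-qnc0-p1 g30, `Cert30.lean`, verbatim). -/
theorem fires_drop_in (D : Finset (Fin N)) (β : Fin N → Fin N → ZMod 3) (c : Fin N → ZMod 3) (x : Fin N → Bool) :
    fires (dropRow D β) (dropOff D c) (dropAct D x) x = (dropAct D x).card := by
  unfold fires
  congr 1
  apply filter_true_of_mem
  intro g hg
  rw [dropAct, mem_filter] at hg
  rw [form_drop_in D β x hg.2, dropOff, if_pos hg.2]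

/-- Auxiliary `fires_drop_out` of the joint-phase certificate engine (planner qa-qnc0-p1 g30, `Cert30.lean`, verbatim). -/
theorem fires_drop_out (D : Finset (Fin N)) (β : Fin N → Fin N → ZMod 3) (c : Fin N → ZMod 3) (x : Fin N → Bool) :
    fires (dropRow D β) (dropOff D c) ((act x).filter fun g => ¬ g ∈ D) x = fires β c ((act x).filter fun g => ¬ g ∈ D) x := by
  unfold fires
  congr 1
  apply filter_congr
  intro g hg
  rw [mem_filter] at hg
  rw [form_drop_out D β x hg.2, dropOff, if_neg hg.2]

/-- Drop parity ⇒ the drop competitor agrees in active parity. -/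
theorem actParityAgree_drop (D : Finset (Fin N)) (β : Fin N → Fin N → ZMod 3) (c : Fin N → ZMod 3) {x : Fin N → Bool}
    (h : DropParityAt D β c x) : ActParityAgree β c (fun x => affBell (dropRow D β) (dropOff D c) x) x := by
  unfold ActParityAgree
  rw [activeOnes_affBell β c rfl, activeOnes_affBell (dropRow D β) (dropOff D c) rfl]
  have hs1 := fires_split β c (act x) x (fun g => g ∈ D)
  have hs2 := fires_split (dropRow D β) (dropOff D c) (act x) x (fun g => g ∈ D)
  have hw := fires_drop_in D β c x
  have hn := fires_drop_out D β c x
  unfold DropParityAt DesigParityAt at h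
  unfold dropAct at h hw
  rw [hs1, hs2, hw, hn]
  omega

/-- The inputs read by the `b`-th bit of the drop competitor. -/
def dropReads (D : Finset (Fin N)) (β : Fin N → Fin N → ZMod 3) (b : Fin N) : Finset (Fin N) :=
  if b ∈ D then ∅ else rowSupp β b

/-- Auxiliary `readsOnly_drop` of the joint-phase certificate engine (planner qa-qnc0-p1 g30, `Cert30.lean`, verbatim). -/
theorem readsOnly_drop (D : Finset (Fin N)) (β : Fin N → Fin N → ZMod 3) (c : Fin N → ZMod 3) (b : Fin N) :
    AffBells22.ReadsOnly (dropReads D β b) (fun x => affBell (dropRow D β) (dropOff D c) x b) := by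
  intro x x' h
  by_cases hb : b ∈ D
  · rw [Bool.eq_iff_iff, affBell_eq_true_iff, affBell_eq_true_iff, form_drop_in D β x hb, form_drop_in D β x' hb]
  · have hr : dropReads D β b = rowSupp β b := by rw [dropReads, if_neg hb]
    rw [hr] at h
    have := readsOnly_affBell β c b x x' h
    rw [Bool.eq_iff_iff, affBell_eq_true_iff, affBell_eq_true_iff] at this
    rw [Bool.eq_iff_iff, affBell_eq_true_iff, affBell_eq_true_iff, form_drop_out D β x hb, form_drop_out D β x' hb,
      dropOff, if_neg hb]
    exact this

/-- The drop competitor's bits have degree `≤ L` when every KEPT row has width `≤ L`. -/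
theorem bitFn_drop_lowDeg (D : Finset (Fin N)) (L : ℕ) (β : Fin N → Fin N → ZMod 3) (c : Fin N → ZMod 3)
    (hD : ∀ b, b ∉ D → (rowSupp β b).card ≤ L) (k : Fin N) :
    bitFn (fun x => affBell (dropRow D β) (dropOff D c) x) k ∈ lowDeg (ZMod 2) N L := by
  have hcard : (dropReads D β k).card ≤ L := by
    unfold dropReads
    by_cases hk : k ∈ D
    · simp [hk]
    · rw [if_neg hk]; exact hD k hk
  exact lowDeg_mono hcard (AffBells22.indicator_mem_lowDeg (dropReads D β k) _ (readsOnly_drop D β c k))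

/-- **DROP ENGINE (PROVED): `x ∉ cutPoints ∧ CertShapeW (dropAct D x) ⇒ DropParityAt D`.** -/
theorem dropParity_of_cert (hN : 3 ≤ N) (D : Finset (Fin N)) (β : Fin N → Fin N → ZMod 3) (c : Fin N → ZMod 3) {x : Fin N → Bool}
    (hx : IsOdd x) (hnc : x ∉ cutPoints β c) (h : CertShapeW (dropAct D x) β x) : DropParityAt D β c x :=
  desigParity_of_cert hN β c (fun _ hg => (mem_filter.1 hg).1) hx hnc h

/-- **POINT COUNT (PROVED):** `#{x odd : ¬DropParityAt D} ≤ #{x odd : ¬CertShapeW (dropAct D x)} + #cutPoints`. -/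
theorem card_not_dropParity_le_cert (hN : 3 ≤ N) (D : Finset (Fin N)) (β : Fin N → Fin N → ZMod 3) (c : Fin N → ZMod 3) :
    (univ.filter fun x : Fin N → Bool => IsOdd x ∧ ¬ DropParityAt D β c x).card
      ≤ (univ.filter fun x : Fin N → Bool => IsOdd x ∧ ¬ CertShapeW (dropAct D x) β x).card + (cutPoints β c).card := by
  refine le_trans (card_le_card ?_) (card_union_le _ _)
  intro x hx
  rw [mem_filter] at hx
  rw [mem_union, mem_filter]
  by_cases hsh : CertShapeW (dropAct D x) β x
  · by_cases hcut : x ∈ cutPoints β c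
    · exact Or.inr hcut
    · exact absurd (dropParity_of_cert hN D β c hx.2.1 hcut hsh) hx.2.2
  · exact Or.inl ⟨mem_univ _, hx.2.1, hsh⟩

/-! ### §C.5 `HDrop` — THE conjecture of the line after ROUND-29 — and `HDrop → HAbs → (NP₁)` (PROVED) -/

/-- **`HDrop`** — far affine strategies with few coin-pair cut points admit a DROP SET `D` of rows, with every kept row of width
`≤ (log₂ N)^C`, whose dropped active rows fire with parity `≡` their number at all but an `ε`-fraction of the odd class.
(`D` is chosen per `(N, β, c)`; for run-twin tilings `D` = the whole runs with a wide core.)  Why it might fail: a far, a.e.-pure strategy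
whose wide rows cannot be completed to a parity-balanced drop set by polylog-narrow rows — it would need wide twin-blocks whose balance
is coupled to narrow blocks through shared window reads (ROUND-29 §4, risk R4); none known.  Route to a proof: (I) the pointwise
certificate `dropParity_of_cert` at points where no class straddles `D` (generic position; rank census K-44/K-44p), (II) BLOCK BALANCE of
the twin-blocks that can straddle, learned from the points where they are separated (non-pointwise; ROUND-29 §4). -/
def HDrop : Prop :=
  ∃ δ₀ : ℝ, δ₀ < 1 / 2 ∧ ∃ r₀ w₀ : ℕ, ∀ ε : ℝ, 0 < ε → ∃ C a n₀ : ℕ, ∀ N ≥ n₀, ∀ (β : Fin N → Fin N → ZMod 3) (c : Fin N → ZMod 3),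
    ¬ FrameDecomp δ₀ r₀ w₀ β →
    ((cutPoints β c).card : ℝ) ≤ (2 : ℝ) ^ (N - 1) / (N : ℝ) ^ a →
      ∃ D : Finset (Fin N), (∀ b, b ∉ D → (rowSupp β b).card ≤ (Nat.log 2 N) ^ C) ∧
        (((univ.filter fun x : Fin N → Bool => IsOdd x ∧ ¬ DropParityAt D β c x).card : ℝ) ≤ ε * (2 : ℝ) ^ (N - 1))

/-- **`HDrop → HAbs` (PROVED):** the competitor is the drop strategy of the `D` supplied by the hypothesis. -/
theorem hAbs_of_hDrop (h : HDrop) : HAbs := by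
  obtain ⟨δ₀, hδ₀, r₀, w₀, hW⟩ := h
  refine ⟨δ₀, hδ₀, r₀, w₀, fun ε hε => ?_⟩
  obtain ⟨C, a, n₀, hW⟩ := hW ε hε
  refine ⟨C, a, n₀, fun N hN β c hfr hcut => ?_⟩
  obtain ⟨D, hD, hcard⟩ := hW N hN β c hfr hcut
  refine ⟨fun x => affBell (dropRow D β) (dropOff D c) x, fun k => bitFn_drop_lowDeg D _ β c hD k, ?_⟩
  refine le_trans ?_ hcard
  exact_mod_cast card_le_card fun x hx => by
    rw [mem_filter] at hx ⊢
    exact ⟨hx.1, hx.2.1, fun hP => hx.2.2 (actParityAgree_drop D β c hP)⟩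

/-- **`HDrop → (NP₁)` (PROVED).**  After this file the open statement between the tree and `(NP₁) = AffBellsPolyLoss3` on this line
is `HDrop` (socket `HAbs`). -/
theorem polyLoss_of_hDrop (h : HDrop) : AffBellsPolyLoss3 := polyLoss_of_hAbs (hAbs_of_hDrop h)

/-! ### §C.6 RECORD ONLY — the threshold forms `HWideE`, `HCert` (REFUTED AS TYPED, risk R3) and their (true) implications

Both conjectures below, like the tree's `HWide` and `HShape`, designate the wide set by a WIDTH THRESHOLD and are FALSE as typed:
GRADED sparse-core run-twin tilings (cores of every width in `[0, C·log₂ N + 1]`, `N/(6 C log₂ N)` runs per width) are far and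
cut-free and straddle every threshold `w ≤ C log₂ N`, so `WideParityAt w` fails at ≈ half the odd class for every such `w`
(`exp30/grt_check2.py`; ROUND-29 §2).  The implications proved here remain correct and document why the drop-set form is forced. -/

/-- **`HWideE`** [REFUTED AS TYPED — risk R3, graded sparse-core run-twin tilings; record only] — `HWide` with the width chosen per
strategy (`∃ w ≤ C·log₂ N` inside).  `HWide → HWideE` trivially (`hWideE_of_hWide`). -/
def HWideE : Prop :=
  ∃ δ₀ : ℝ, δ₀ < 1 / 2 ∧ ∃ r₀ w₀ : ℕ, ∀ ε : ℝ, 0 < ε → ∃ C a n₀ : ℕ, ∀ N ≥ n₀, ∀ (β : Fin N → Fin N → ZMod 3) (c : Fin N → ZMod 3),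
    ¬ FrameDecomp δ₀ r₀ w₀ β →
    ((cutPoints β c).card : ℝ) ≤ (2 : ℝ) ^ (N - 1) / (N : ℝ) ^ a →
      ∃ w ≤ C * Nat.log 2 N,
        (((univ.filter fun x : Fin N → Bool => IsOdd x ∧ ¬ WideParityAt w β c x).card : ℝ) ≤ ε * (2 : ℝ) ^ (N - 1))

/-- **`HCert`** [REFUTED AS TYPED — risk R3: graded sparse-core run-twin tilings straddle every threshold (mixed classes) and their
thinnest cores are near-blind; record only; superseded by `HDrop` (§C.5)] — far affine strategies with few coin-pair cut points admit,
for some width `w ≤ C·log₂ N`, a joint-phase certificate at all but an `ε`-fraction of the odd class. -/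
def HCert : Prop :=
  ∃ δ₀ : ℝ, δ₀ < 1 / 2 ∧ ∃ r₀ w₀ : ℕ, ∀ ε : ℝ, 0 < ε → ∃ C a n₀ : ℕ, ∀ N ≥ n₀, ∀ (β : Fin N → Fin N → ZMod 3) (c : Fin N → ZMod 3),
    ¬ FrameDecomp δ₀ r₀ w₀ β →
    ((cutPoints β c).card : ℝ) ≤ (2 : ℝ) ^ (N - 1) / (N : ℝ) ^ a →
      ∃ w ≤ C * Nat.log 2 N,
        (((univ.filter fun x : Fin N → Bool => IsOdd x ∧ ¬ CertShape w β x).card : ℝ) ≤ ε * (2 : ℝ) ^ (N - 1))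

/-- `HWide → HWideE` (PROVED, trivial: take `w = C·log₂ N`). -/
theorem hWideE_of_hWide (h : HWide) : HWideE := by
  obtain ⟨δ₀, hδ₀, r₀, w₀, hS⟩ := h
  refine ⟨δ₀, hδ₀, r₀, w₀, fun ε hε => ?_⟩
  obtain ⟨C, a, n₀, hS⟩ := hS ε hε
  exact ⟨C, a, n₀, fun N hN β c hfr hcut => ⟨C * Nat.log 2 N, le_rfl, hS N hN β c hfr hcut⟩⟩

/-- **`HCert → HWideE` (PROVED)** — by `card_not_wideParity_le_cert`: the bad set is the certificate-less points plus the cut points. -/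
theorem hWideE_of_hCert (h : HCert) : HWideE := by
  obtain ⟨δ₀, hδ₀, r₀, w₀, hS⟩ := h
  refine ⟨δ₀, hδ₀, r₀, w₀, fun ε hε => ?_⟩
  have hε2 : (0 : ℝ) < ε / 2 := by linarith
  obtain ⟨C, a, n₀, hS⟩ := hS (ε / 2) hε2
  obtain ⟨M, hM⟩ := exists_nat_gt (2 / ε)
  refine ⟨C, max a 1, max (max n₀ 3) M, fun N hN β c hfr hcut => ?_⟩
  have hN₀ : n₀ ≤ N := le_trans (le_trans (le_max_left _ _) (le_max_left _ _)) hN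
  have h3 : 3 ≤ N := le_trans (le_trans (le_max_right _ _) (le_max_left _ _)) hN
  have hNM : M ≤ N := le_trans (le_max_right _ _) hN
  have hNpos : (0 : ℝ) < N := by exact_mod_cast (show 0 < N by omega)
  have hN1 : (1 : ℝ) ≤ N := by exact_mod_cast (show 1 ≤ N by omega)
  have h2pow : (0 : ℝ) < (2 : ℝ) ^ (N - 1) := by positivity
  have hpow_a : (N : ℝ) ^ a ≤ (N : ℝ) ^ (max a 1) := pow_le_pow_right₀ hN1 (le_max_left _ _)
  have hpow_1 : (N : ℝ) ^ 1 ≤ (N : ℝ) ^ (max a 1) := pow_le_pow_right₀ hN1 (le_max_right _ _)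
  have hNa : (0 : ℝ) < (N : ℝ) ^ a := by positivity
  have hcut' : ((cutPoints β c).card : ℝ) ≤ (2 : ℝ) ^ (N - 1) / (N : ℝ) ^ a :=
    le_trans hcut (div_le_div_of_nonneg_left h2pow.le hNa hpow_a)
  obtain ⟨w, hw, h1⟩ := hS N hN₀ β c hfr hcut'
  refine ⟨w, hw, ?_⟩
  have h2 : ((univ.filter fun x : Fin N → Bool => IsOdd x ∧ ¬ WideParityAt w β c x).card : ℝ)
      ≤ ((univ.filter fun x : Fin N → Bool => IsOdd x ∧ ¬ CertShape w β x).card : ℝ) + (cutPoints β c).card := by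
    exact_mod_cast card_not_wideParity_le_cert h3 w β c
  -- #cut ≤ 2^{N-1}/N^{max a 1} ≤ 2^{N-1}/N ≤ (ε/2)·2^{N-1}
  have hεN : 2 / (N : ℝ) ≤ ε := by
    have hNt : 2 / ε < (N : ℝ) := lt_of_lt_of_le hM (by exact_mod_cast hNM)
    rw [div_le_iff₀ hNpos]
    have := (div_lt_iff₀ hε).1 hNt
    linarith
  have hterm : ((cutPoints β c).card : ℝ) ≤ (ε / 2) * (2 : ℝ) ^ (N - 1) := by
    have hA : ((cutPoints β c).card : ℝ) ≤ (2 : ℝ) ^ (N - 1) / (N : ℝ) ^ 1 :=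
      le_trans hcut (div_le_div_of_nonneg_left h2pow.le (by positivity) hpow_1)
    rw [pow_one] at hA
    have hB : (2 : ℝ) ^ (N - 1) / (N : ℝ) = (2 / (N : ℝ)) / 2 * (2 : ℝ) ^ (N - 1) := by
      field_simp
    rw [hB] at hA
    have hC : (2 / (N : ℝ)) / 2 * (2 : ℝ) ^ (N - 1) ≤ (ε / 2) * (2 : ℝ) ^ (N - 1) :=
      mul_le_mul_of_nonneg_right (by linarith) h2pow.le
    linarith
  linarith

/-! #### (record) `HWideE → HAbs` and `HCert → AffBellsPolyLoss3` (PROVED implications of refuted hypotheses) -/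

/-- **`HWideE → HAbs` (PROVED)** — as the tree's `hAbs_of_hWide`, with the threshold `w ≤ C·log₂ N` supplied pointwise-in-`(N,β,c)` by
the hypothesis: the low-degree competitor is the frame shadow at that `w` (`bitFn_shadow_lowDeg` is already stated for every
`w ≤ C·log₂ N`), and wide parity gives active-parity agreement (`actParityAgree_shadow`). -/
theorem hAbs_of_hWideE (h : HWideE) : HAbs := by
  obtain ⟨δ₀, hδ₀, r₀, w₀, hW⟩ := h
  refine ⟨δ₀, hδ₀, r₀, w₀, fun ε hε => ?_⟩
  obtain ⟨C, a, n₀, hW⟩ := hW ε hε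
  refine ⟨2, a, max n₀ (2 ^ C), fun N hN β c hfr hcut => ?_⟩
  have hN₀ : n₀ ≤ N := le_trans (le_max_left _ _) hN
  have hNC : 2 ^ C ≤ N := le_trans (le_max_right _ _) hN
  obtain ⟨w, hwC, hcard⟩ := hW N hN₀ β c hfr hcut
  refine ⟨fun x => affBell (shadowRow w β) (shadowOff w β c) x, fun k => bitFn_shadow_lowDeg C w hNC hwC β c k, ?_⟩
  refine le_trans ?_ hcard
  exact_mod_cast card_le_card fun x hx => by
    rw [mem_filter] at hx ⊢
    exact ⟨hx.1, hx.2.1, fun hWP => hx.2.2 (actParityAgree_shadow _ β c hWP)⟩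

/-- `HCert → (NP₁)` (PROVED implication; `HCert` itself is refuted as typed, §C.6 header). -/
theorem polyLoss_of_hCert (h : HCert) : AffBellsPolyLoss3 :=
  polyLoss_of_hAbs (hAbs_of_hWideE (hWideE_of_hCert h))

/-- The same for the threshold-free wide-parity form. -/
theorem polyLoss_of_hWideE (h : HWideE) : AffBellsPolyLoss3 := polyLoss_of_hAbs (hAbs_of_hWideE h)


end AffBells30

end Summit.QuantumAdvantage.AdviceFreeQNC0
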